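import Mathlib
import Summits.Ventures.HodgeRepro.Tier4.Common.AdelicDefs
import Summits.Ventures.HodgeRepro.Tier4.Common.MixedPlaneCusp
import Summits.Ventures.HodgeRepro.Tier4.Common.CocompactBridge
import Summits.Ventures.HodgeRepro.Tier4.LitCompactnessPlane
import Summits.Ventures.HodgeRepro.Tier4.Line1.RationalPoints
import Summits.Ventures.HodgeRepro.Tier4.Line1.LocallyCompactGA
import Summits.Ventures.HodgeRepro.Tier4.Line1.RealisedSettingAniso
import Summits.Ventures.HodgeRepro.Tier4.Line4.TorusCocompactAniso

/-!
# Tier4/Line4/WallDataOfPrint — the geometric data of the L4 wall (`R _hR μ DG fdG compG compT compT'`) EXIST on every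
anisotropic genuine plane, from the characters and ONE typed print (the bridge's half (C) as one theorem)

Blind re-derivation cell `pub-hodge-repro`, Tier 4 «prove the step» (README §9–§10), seat t4-L4-p2 (prover, LINE L4,
gen 6).  Tree path `lean/Summits/Ventures/HodgeRepro/Tier4/Line4/WallDataOfPrint.lean`.  Glue of tree theorems; no
definition, no instance; the ONE printed input is the DISPLAYED hypothesis
`hp : Lit.BorelHarishChandra1962_Thm11_8_cocompact_plane_aniso W` (lit-3 p696518 — Borel–Harish-Chandra 1962 Thm 11.8 /
Borel 1963 Thm 5.6 (ii) at the plane, as typed; nothing of it is proved here).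

WHAT IS PROVED.  `exists_wall_data_of_print`: for an anisotropic genuine plane `W` and characters `χ`, `χ′` of its
adelic tori (multiplicative, trivial on the rational points, matching on the centre — the five character fields of
`RTFData`), there are an `RTFData W` with those characters, a Haar measure `μ` on `U(W)(𝔸_k)` and a set `DG` such that
`R.IsHaar`, `DG` is a fundamental domain of the rational points for `μ` with compact closure, and the torus domains
`R.DT`, `R.DT'` have compact closure — exactly the data the wall `mixed_two_torus_W3` (Skeleton v0.46 L2675ff) takes
as binders `R _hR μ [μ.IsHaarMeasure] DG fdG compG compT compT'`.  Ingredients by name: the torus half from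
`exists_rtfData_isHaar_closure_of_anisotropic` (TorusCocompactAniso p718934: L1-p5's torus bridge on `IsAnisotropic`),
the plane-group half from L1-p5's `quotient_compact_genuine_aniso` (RealisedSettingAniso: the print instantiated +
`quotient_compact_of_cocompact`) at Mathlib's `Measure.haar` on the locally compact Hausdorff `U(W)(𝔸_k)`
(`locallyCompact_GA`, `t2Space_GA`).

READING FOR THE LINE.  On the wall's seesaw plane — anisotropic (L2-p2's SeesawAnisotropic, under the dictionary) and
genuine (`SeesawDistribution.isGenuineRow_seesawPlane`) — the bridge's half (C) is therefore BY NAME from the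
characters (half (B)) and the one typed print; what the bridge still has to produce for the wall is (A3) the genuine
second plane, (B) the characters / `K`-types, and (D).  Nothing here says anything about the status of the Hodge
conjecture for CM abelian varieties, which is NOT proved; HC_CM is NOT proved by anyone in this repository.
-/

set_option autoImplicit false

noncomputable section

namespace Summit.Ventures.HodgeRepro.Tier4.Line4

open NumberField MeasureTheory Summit.Ventures.HodgeRepro.Tier4.Common Summit.Ventures.HodgeRepro.Tier4.Line1
  Topology

variable {k : Type} [Field k] [NumberField k] (W : PlaneData k)

/-- **The wall's geometric data exist from the characters and ONE typed print** (anisotropic genuine plane): an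
`RTFData` with the given characters, Haar on the tori with relatively compact fundamental domains, and a Haar
measure on `U(W)(𝔸_k)` with a relatively compact fundamental domain of the rational points — the binders
`R _hR μ DG fdG compG compT compT'` of `mixed_two_torus_W3`, produced. -/
theorem exists_wall_data_of_print [MeasurableSpace (GA W)] [BorelSpace (GA W)]
    [MeasurableSpace (torusT W)] [BorelSpace (torusT W)]
    [MeasurableSpace (torusT' W)] [BorelSpace (torusT' W)]
    (hp : Lit.BorelHarishChandra1962_Thm11_8_cocompact_plane_aniso W)
    (hg : IsGenuineRow W) (hA : IsAnisotropic W)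
    (chi : torusT W → ℂ) (chi' : torusT' W → ℂ)
    (chi_mul : ∀ s t : torusT W, chi (s * t) = chi s * chi t)
    (chi'_mul : ∀ s t : torusT' W, chi' (s * t) = chi' s * chi' t)
    (chi_rational : ∀ t : torusT W, (t : GA W) ∈ rationalPoints W → chi t = 1)
    (chi'_rational : ∀ t : torusT' W, (t : GA W) ∈ rationalPoints W → chi' t = 1)
    (chi_centre : ∀ (z : GA W) (hz : z ∈ centre W),
      chi ⟨z, centre_le_torusT W hz⟩ = chi' ⟨z, centre_le_torusT' W hz⟩) :
    ∃ (R : RTFData W) (μ : Measure (GA W)) (DG : Set (GA W)),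
      R.chi = chi ∧ R.chi' = chi' ∧ R.IsHaar ∧ μ.IsHaarMeasure ∧
      IsFundamentalDomain (rationalPoints W) DG μ ∧ IsCompact (closure DG) ∧
      IsCompact (closure R.DT) ∧ IsCompact (closure R.DT') := by
  haveI := locallyCompact_GA W
  haveI := t2Space_GA W
  obtain ⟨R, hchi, hchi', hRH, -, -, hT, hT'⟩ :=
    exists_rtfData_isHaar_closure_of_anisotropic W hg hA chi chi' chi_mul chi'_mul chi_rational chi'_rational
      chi_centre
  obtain ⟨DG, hfd, hcpt⟩ := quotient_compact_genuine_aniso W hp hg hA (Measure.haar : Measure (GA W))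
  exact ⟨R, Measure.haar, DG, hchi, hchi', hRH, inferInstance, hfd, hcpt, hT, hT'⟩

end Summit.Ventures.HodgeRepro.Tier4.Line4

end
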